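import Mathlib
import HarnessLib
import Summits.HubbardSuperconductivity.HubbardSuperconductivity.Theorems.KLProgrammePerturbedFermiCurveCompDiffGraded

/-!
# Route `KLProgramme` — K3 engine child (stmt-HubbardSuperconductivity-19918, `stub_twoLeg_step`, clause (E3a-MS) `TwoLegSizesMST`):
# transport of the FRAME-INCREMENT sizes to the two-frame hypotheses of (P2)

Cell `gate-hubbard-kl`, seat hubbard-kl-k3c3-p3 (g3) «implicit-function / monotonicity route for μ(n)», part (P2) of the (L)+(F) recipe.
The two-frame lemmas of `…TwoFrameRegime` / `…TwoFrameGraded` / `…CompDiffGraded` take the difference `δ_{K′} − δ_K` through NESTED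
Fréchet derivatives on `Fin 2 → ℝ` over the closed square.  In slot `m` of (F) the consumer holds `K′` with `K′.eval = K.eval + H.eval` for an
increment `H : TrigPolyC4v` (a Jackson high part) whose sizes are known on `Momentum`: `‖Dʲ(frameShift H)(q)‖ ≤ h j` (`j ≤ 4`).  This file
is the dictionary:

* §1 `fderiv_iter_add_of_contDiff`: nested derivatives of a sum of `C^∞` functions, orders 1–4 (as functions);
* §2 `frame_diff_transport`: `|δ_{K′} − δ_K| ≤ h 0`, `‖D(δ_{K′}) − D(δ_K)‖ ≤ 2·h 1`, `‖D²…‖ ≤ 4·h 2`, `‖D³…‖ ≤ 8·h 3`, `‖D⁴…‖ ≤ 16·h 4`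
  (everywhere, in particular on the closed square) — exactly the hypotheses `hE₀ … hE₄` of the graded lemmas with `E_i = 2^i·h i`;
* §3 `abs_iteratedDeriv_comp_sub_le_graded_of_increment`: the one-call composite bound of `…CompDiffGraded` RE-KEYED by the increment:
  if `h j ≤ η·λ^j` (`j ≤ 4`) then the graded hypotheses hold with `e = η` and scale `2λ` (since `2^j η λ^j = η (2λ)^j`), so orders 0–4 of
  `|∂ʲ(F∘γ_{K′}) − ∂ʲ(F∘γ_K)|` are bounded by the `…CompDiffGraded` numerals read at `(e, λ) := (η, 2λ)` — stated here for order 0 and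
  order 4 (the binding ones; orders 1–3 are the same call with `_one/_two/_three`).

Everything is PROVED; no definitions, no named facts. [folklore]
-/

noncomputable section

namespace Summit.HubbardSuperconductivity.HubbardSuperconductivity.Theorems.PerturbedFermiCurve

set_option linter.dupNamespace false -- summit = problem name (single-conjunct summit), D-0017
set_option maxSynthPendingDepth 4 -- nested operator-norm instances (up to fifth Fréchet derivatives)

open Real Set
open Literature.MathematicalPhysics.QuantumLattice Literature.MathematicalPhysics.QuantumLattice.BandSectorCounting
open Summit.HubbardSuperconductivity.HubbardSuperconductivity.Theorems.DispersionFlow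
open Summit.HubbardSuperconductivity.HubbardSuperconductivity.Theorems.KLRegimeSplit

/-! ## §1 Nested derivatives of a sum -/

/-- **Nested derivatives of a sum of smooth functions**, orders 1–4, as functions. [folklore] -/
theorem fderiv_iter_add_of_contDiff {f g : (Fin 2 → ℝ) → ℝ} (hf : ContDiff ℝ 4 f) (hg : ContDiff ℝ 4 g) :
    fderiv ℝ (f + g) = fderiv ℝ f + fderiv ℝ g ∧
    fderiv ℝ (fderiv ℝ (f + g)) = fderiv ℝ (fderiv ℝ f) + fderiv ℝ (fderiv ℝ g) ∧
    fderiv ℝ (fderiv ℝ (fderiv ℝ (f + g))) = fderiv ℝ (fderiv ℝ (fderiv ℝ f)) + fderiv ℝ (fderiv ℝ (fderiv ℝ g)) ∧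
    fderiv ℝ (fderiv ℝ (fderiv ℝ (fderiv ℝ (f + g)))) =
      fderiv ℝ (fderiv ℝ (fderiv ℝ (fderiv ℝ f))) + fderiv ℝ (fderiv ℝ (fderiv ℝ (fderiv ℝ g))) := by
  have f0 : Differentiable ℝ f := hf.differentiable (by norm_num)
  have g0 : Differentiable ℝ g := hg.differentiable (by norm_num)
  have f1 : Differentiable ℝ (fderiv ℝ f) := (hf.fderiv_right (m := 3) (by norm_num)).differentiable (by norm_num)
  have g1 : Differentiable ℝ (fderiv ℝ g) := (hg.fderiv_right (m := 3) (by norm_num)).differentiable (by norm_num)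
  have f2 : Differentiable ℝ (fderiv ℝ (fderiv ℝ f)) :=
    ((hf.fderiv_right (m := 3) (by norm_num)).fderiv_right (m := 2) (by norm_num)).differentiable (by norm_num)
  have g2 : Differentiable ℝ (fderiv ℝ (fderiv ℝ g)) :=
    ((hg.fderiv_right (m := 3) (by norm_num)).fderiv_right (m := 2) (by norm_num)).differentiable (by norm_num)
  have f3 : Differentiable ℝ (fderiv ℝ (fderiv ℝ (fderiv ℝ f))) :=
    (((hf.fderiv_right (m := 3) (by norm_num)).fderiv_right (m := 2) (by norm_num)).fderiv_right (m := 1)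
      (by norm_num)).differentiable one_ne_zero
  have g3 : Differentiable ℝ (fderiv ℝ (fderiv ℝ (fderiv ℝ g))) :=
    (((hg.fderiv_right (m := 3) (by norm_num)).fderiv_right (m := 2) (by norm_num)).fderiv_right (m := 1)
      (by norm_num)).differentiable one_ne_zero
  have e1 : fderiv ℝ (f + g) = fderiv ℝ f + fderiv ℝ g := by funext y; exact fderiv_add (f0 y) (g0 y)
  have e2 : fderiv ℝ (fderiv ℝ (f + g)) = fderiv ℝ (fderiv ℝ f) + fderiv ℝ (fderiv ℝ g) := by
    rw [e1]; funext y; exact fderiv_add (f1 y) (g1 y)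
  have e3 : fderiv ℝ (fderiv ℝ (fderiv ℝ (f + g))) = fderiv ℝ (fderiv ℝ (fderiv ℝ f)) + fderiv ℝ (fderiv ℝ (fderiv ℝ g)) := by
    rw [e2]; funext y; exact fderiv_add (f2 y) (g2 y)
  have e4 : fderiv ℝ (fderiv ℝ (fderiv ℝ (fderiv ℝ (f + g)))) =
      fderiv ℝ (fderiv ℝ (fderiv ℝ (fderiv ℝ f))) + fderiv ℝ (fderiv ℝ (fderiv ℝ (fderiv ℝ g))) := by
    rw [e3]; funext y; exact fderiv_add (f3 y) (g3 y)
  exact ⟨e1, e2, e3, e4⟩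

/-! ## §2 The transport -/

/-- **Frame-increment transport**: if `H.eval = K′.eval − K.eval` and `‖Dʲ(frameShift H)‖ ≤ h j` on `Momentum` (`j ≤ 4`), then the nested
differences of `δ_{K′} = −K′.eval` and `δ_K = −K.eval` on `Fin 2 → ℝ` satisfy `|δ_{K′} − δ_K| ≤ h 0`, `‖D^i δ_{K′} − D^i δ_K‖ ≤ 2^i·h i`
(`i = 1 … 4`) at every point — the hypotheses `hE₀ … hE₄` of `…TwoFrameGraded` / `…CompDiffGraded`. [folklore] -/
theorem frame_diff_transport {K K' H : TrigPolyC4v} (hH : ∀ p : Fin 2 → ℝ, H.eval p = K'.eval p - K.eval p) {h : ℕ → ℝ}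
    (hh : ∀ j ≤ 4, ∀ q : Momentum, ‖iteratedFDeriv ℝ j (frameShift H) q‖ ≤ h j) :
    (∀ k : Fin 2 → ℝ, (∀ i, |k i| ≤ π) → |(fun p : Fin 2 → ℝ => -K'.eval p) k - (fun p : Fin 2 → ℝ => -K.eval p) k| ≤ h 0) ∧
    (∀ k : Fin 2 → ℝ, (∀ i, |k i| ≤ π) →
      ‖fderiv ℝ (fun p : Fin 2 → ℝ => -K'.eval p) k - fderiv ℝ (fun p : Fin 2 → ℝ => -K.eval p) k‖ ≤ 2 * h 1) ∧
    (∀ k : Fin 2 → ℝ, (∀ i, |k i| ≤ π) →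
      ‖fderiv ℝ (fderiv ℝ (fun p : Fin 2 → ℝ => -K'.eval p)) k - fderiv ℝ (fderiv ℝ (fun p : Fin 2 → ℝ => -K.eval p)) k‖ ≤
        4 * h 2) ∧
    (∀ k : Fin 2 → ℝ, (∀ i, |k i| ≤ π) →
      ‖fderiv ℝ (fderiv ℝ (fderiv ℝ (fun p : Fin 2 → ℝ => -K'.eval p))) k -
        fderiv ℝ (fderiv ℝ (fderiv ℝ (fun p : Fin 2 → ℝ => -K.eval p))) k‖ ≤ 8 * h 3) ∧
    (∀ k : Fin 2 → ℝ, (∀ i, |k i| ≤ π) →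
      ‖fderiv ℝ (fderiv ℝ (fderiv ℝ (fderiv ℝ (fun p : Fin 2 → ℝ => -K'.eval p)))) k -
        fderiv ℝ (fderiv ℝ (fderiv ℝ (fderiv ℝ (fun p : Fin 2 → ℝ => -K.eval p)))) k‖ ≤ 16 * h 4) := by
  -- δ_{K′} = δ_K + η with η = frameShift H ∘ toLp = −H.eval
  have hsum : (fun p : Fin 2 → ℝ => -K'.eval p) = (fun p : Fin 2 → ℝ => -K.eval p) + fun p : Fin 2 → ℝ => -H.eval p := by
    funext p; simp only [Pi.add_apply, hH p]; ring
  have hCK : ContDiff ℝ 4 (fun p : Fin 2 → ℝ => -K.eval p) := by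
    rw [← frameShift_toLp_eq_neg_eval]; exact contDiff_frameShift_toLp K
  have hCH : ContDiff ℝ 4 (fun p : Fin 2 → ℝ => -H.eval p) := by
    rw [← frameShift_toLp_eq_neg_eval]; exact contDiff_frameShift_toLp H
  obtain ⟨e1, e2, e3, e4⟩ := fderiv_iter_add_of_contDiff hCK hCH
  have T := fun (j : ℕ) (hj : j ≤ 4) (k : Fin 2 → ℝ) => norm_iteratedFDeriv_frameShift_toLp_le_single (hh j hj) k
  refine ⟨fun k _ => ?_, fun k _ => ?_, fun k _ => ?_, fun k _ => ?_, fun k _ => ?_⟩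
  · have h0 := T 0 (by norm_num) k
    rw [norm_iteratedFDeriv_zero, Real.norm_eq_abs, pow_zero, mul_one] at h0
    have : (fun p : Fin 2 → ℝ => -K'.eval p) k - (fun p : Fin 2 → ℝ => -K.eval p) k = frameShift H (WithLp.toLp 2 k) := by
      simp only [frameShift_toLp, hH k]; ring
    rw [this]; exact h0
  · have h1 := T 1 (by norm_num) k
    rw [frameShift_toLp_eq_neg_eval, ← norm_fderiv_eq_norm_iteratedFDeriv_one, pow_one] at h1
    rw [hsum, e1, Pi.add_apply, add_sub_cancel_left]; linarith
  · have h2 := T 2 (by norm_num) k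
    rw [frameShift_toLp_eq_neg_eval, ← norm_fderiv_two_eq_norm_iteratedFDeriv] at h2
    rw [hsum, e2, Pi.add_apply, add_sub_cancel_left]; linarith
  · have h3 := T 3 (by norm_num) k
    rw [frameShift_toLp_eq_neg_eval, ← norm_fderiv_three_eq_norm_iteratedFDeriv] at h3
    rw [hsum, e3, Pi.add_apply, add_sub_cancel_left]; linarith
  · have h4 := T 4 le_rfl k
    rw [frameShift_toLp_eq_neg_eval, ← norm_fderiv_four_eq_norm_iteratedFDeriv] at h4
    rw [hsum, e4, Pi.add_apply, add_sub_cancel_left]; linarith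

/-! ## §3 The one-call bound keyed by the increment -/

section Increment

variable {K K' H : TrigPolyC4v} (hH : ∀ p : Fin 2 → ℝ, H.eval p = K'.eval p - K.eval p) {A : ℝ}
  (hA : ∀ p : Momentum, ∀ j ≤ 2, ‖iteratedFDeriv ℝ j (frameShift K) p‖ ≤ A)
  (hA' : ∀ p : Momentum, ∀ j ≤ 2, ‖iteratedFDeriv ℝ j (frameShift K') p‖ ≤ A) (hA20 : A ≤ 1 / 20)
  (hd : klCurveD ≤ (bandBounds (show (-4 : ℝ) < -1.1 by norm_num) (show (-1.1 : ℝ) ≤ -0.1 by norm_num)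
    (show (-0.1 : ℝ) < 0 by norm_num)).Dtmin - 2 * A)
  {ν : ℝ} (hlo : (-1.1 : ℝ) ≤ ν - A) (hhi : ν + A ≤ -0.1)
  {A₃ A₄ η l : ℝ} (hη : 0 ≤ η) (hl : 1 ≤ l)
  (hA₃ : ∀ p : Momentum, ‖iteratedFDeriv ℝ 3 (frameShift K) p‖ ≤ A₃)
  (hA₃' : ∀ p : Momentum, ‖iteratedFDeriv ℝ 3 (frameShift K') p‖ ≤ A₃) (hA₃l : A₃ ≤ l)
  (hA₄ : ∀ p : Momentum, ‖iteratedFDeriv ℝ 4 (frameShift K) p‖ ≤ A₄)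
  (hA₄' : ∀ p : Momentum, ‖iteratedFDeriv ℝ 4 (frameShift K') p‖ ≤ A₄) (hA₄l : A₄ ≤ l ^ 2)
  {h : ℕ → ℝ} (hh : ∀ j ≤ 4, ∀ q : Momentum, ‖iteratedFDeriv ℝ j (frameShift H) q‖ ≤ h j) (hhη : ∀ j ≤ 4, h j ≤ η * l ^ j)
  {F : Momentum → ℝ} (hF : ContDiff ℝ 5 F) {M₁ M₂ M₃ M₄ M₅ : ℝ}
  (hM₁ : ∀ z, ‖fderiv ℝ F z‖ ≤ M₁) (hM₂ : ∀ z, ‖fderiv ℝ (fderiv ℝ F) z‖ ≤ M₂)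
  (hM₃ : ∀ z, ‖fderiv ℝ (fderiv ℝ (fderiv ℝ F)) z‖ ≤ M₃) (hM₄ : ∀ z, ‖fderiv ℝ (fderiv ℝ (fderiv ℝ (fderiv ℝ F))) z‖ ≤ M₄)
  (hM₅ : ∀ z, ‖fderiv ℝ (fderiv ℝ (fderiv ℝ (fderiv ℝ (fderiv ℝ F)))) z‖ ≤ M₅)
include hH hl hA₃l hA₄l hh hhη

/-- The graded hypotheses `hE₀ … hE₄` hold with `e = η` and scale `2λ` (`2^jηλ^j = η(2λ)^j`), and the size hypotheses with scale `2λ`. -/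
theorem graded_hyps_of_increment :
    (∀ k : Fin 2 → ℝ, (∀ i, |k i| ≤ π) → |(fun p : Fin 2 → ℝ => -K'.eval p) k - (fun p : Fin 2 → ℝ => -K.eval p) k| ≤ η) ∧
    (∀ k : Fin 2 → ℝ, (∀ i, |k i| ≤ π) →
      ‖fderiv ℝ (fun p : Fin 2 → ℝ => -K'.eval p) k - fderiv ℝ (fun p : Fin 2 → ℝ => -K.eval p) k‖ ≤ η * (2 * l)) ∧
    (∀ k : Fin 2 → ℝ, (∀ i, |k i| ≤ π) →
      ‖fderiv ℝ (fderiv ℝ (fun p : Fin 2 → ℝ => -K'.eval p)) k - fderiv ℝ (fderiv ℝ (fun p : Fin 2 → ℝ => -K.eval p)) k‖ ≤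
        η * (2 * l) ^ 2) ∧
    (∀ k : Fin 2 → ℝ, (∀ i, |k i| ≤ π) →
      ‖fderiv ℝ (fderiv ℝ (fderiv ℝ (fun p : Fin 2 → ℝ => -K'.eval p))) k -
        fderiv ℝ (fderiv ℝ (fderiv ℝ (fun p : Fin 2 → ℝ => -K.eval p))) k‖ ≤ η * (2 * l) ^ 3) ∧
    (∀ k : Fin 2 → ℝ, (∀ i, |k i| ≤ π) →
      ‖fderiv ℝ (fderiv ℝ (fderiv ℝ (fderiv ℝ (fun p : Fin 2 → ℝ => -K'.eval p)))) k -
        fderiv ℝ (fderiv ℝ (fderiv ℝ (fderiv ℝ (fun p : Fin 2 → ℝ => -K.eval p)))) k‖ ≤ η * (2 * l) ^ 4) ∧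
    1 ≤ 2 * l ∧ A₃ ≤ 2 * l ∧ A₄ ≤ (2 * l) ^ 2 := by
  obtain ⟨t0, t1, t2, t3, t4⟩ := frame_diff_transport hH hh
  have g0 := hhη 0 (by norm_num); have g1 := hhη 1 (by norm_num); have g2 := hhη 2 (by norm_num)
  have g3 := hhη 3 (by norm_num); have g4 := hhη 4 le_rfl
  have hl0 : 0 ≤ l := zero_le_one.trans hl
  refine ⟨fun k hk => (t0 k hk).trans (by simpa using g0), fun k hk => (t1 k hk).trans (by linarith),
    fun k hk => (t2 k hk).trans (by nlinarith), fun k hk => (t3 k hk).trans (by nlinarith), fun k hk => (t4 k hk).trans (by nlinarith),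
    by linarith, by linarith, by nlinarith⟩

include hA hA' hA20 hd hlo hhi hη hA₃ hA₃' hA₄ hA₄' hF hM₁ in
/-- **Order 0, keyed by the increment**: `|F(γ_{K′}θ) − F(γ_Kθ)| ≤ 12.2·M₁·η`. [folklore] -/
theorem abs_comp_sub_le_graded_zero_of_increment (θ : ℝ) :
    |F (WithLp.toLp 2 (klFermiPoint ν K' θ)) - F (WithLp.toLp 2 (klFermiPoint ν K θ))| ≤ 12.2 * M₁ * η := by
  obtain ⟨s0, s1, s2, s3, s4, hl2, hA₃2, hA₄2⟩ := graded_hyps_of_increment hH hl hA₃l hA₄l hh hhη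
  exact abs_comp_sub_le_graded_zero hA hA' hA20 hd hlo hhi hη hl2 hA₃ hA₃' hA₃2 hA₄ hA₄' hA₄2 s0 s1 s2 s3 s4 hF hM₁ θ

include hA hA' hA20 hd hlo hhi hη hA₃ hA₃' hA₄ hA₄' hF hM₁ hM₂ hM₃ hM₄ hM₅ in
/-- **Order 4, keyed by the increment**: the `…CompDiffGraded` order-4 numerals read at scale `2λ`:
`|∂⁴(F∘γ_{K′}) − ∂⁴(F∘γ_K)| ≤ η·(1.19·10¹⁷·M₁(2λ)⁴ + 8.79·10¹⁵·M₂(2λ)³ + 2.8·10¹⁴·M₃(2λ)² + 4.6·10¹²·M₄(2λ) + 3.48·10¹⁰·M₅) + 6.92·10¹⁰·M₁·A₄`.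
(Orders 1–3: the same call with `abs_iteratedDeriv_comp_sub_le_graded_one/_two/_three` and `graded_hyps_of_increment`.) [folklore] -/
theorem abs_iteratedDeriv_four_comp_sub_le_graded_of_increment (θ : ℝ) :
    |iteratedDeriv 4 (F ∘ fun θ : ℝ => (WithLp.toLp 2 (klFermiPoint ν K' θ) : Momentum)) θ -
        iteratedDeriv 4 (F ∘ fun θ : ℝ => (WithLp.toLp 2 (klFermiPoint ν K θ) : Momentum)) θ| ≤
      η * (119000000000000000 * M₁ * (2 * l) ^ 4 + 8790000000000000 * M₂ * (2 * l) ^ 3 + 280000000000000 * M₃ * (2 * l) ^ 2 +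
          4600000000000 * M₄ * (2 * l) + 34800000000 * M₅) + 69200000000 * M₁ * A₄ := by
  obtain ⟨s0, s1, s2, s3, s4, hl2, hA₃2, hA₄2⟩ := graded_hyps_of_increment hH hl hA₃l hA₄l hh hhη
  exact abs_iteratedDeriv_comp_sub_le_graded_four hA hA' hA20 hd hlo hhi hη hl2 hA₃ hA₃' hA₃2 hA₄ hA₄' hA₄2 s0 s1 s2 s3 s4 hF hM₁ hM₂
    hM₃ hM₄ hM₅ θ

end Increment

end Summit.HubbardSuperconductivity.HubbardSuperconductivity.Theorems.PerturbedFermiCurve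

end
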